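import Summits.BirchSwinnertonDyer.BirchSwinnertonDyer.Theorems.PrintCf2SplitBadTwoUnrBaseLift
import Summits.BirchSwinnertonDyer.BirchSwinnertonDyer.Theorems.PrintCf2SplitBadTwoRestrictedConjInputsOfFrame
import Summits.BirchSwinnertonDyer.BirchSwinnertonDyer.Theorems.PrintCf2SplitBadTwoRestrictedSelmerBaseFiniteOfFrame
import Summits.BirchSwinnertonDyer.BirchSwinnertonDyer.Theorems.SchneiderFreeAdditiveX3PoitouTateShaDualityHolds
import Summits.BirchSwinnertonDyer.BirchSwinnertonDyer.Theorems.SchneiderFreeAdditiveX3PoitouTateSelmerDualityHolds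
import Literature.NumberTheory.GaloisRepresentations.NumberFieldCdTwoProofs
import HarnessLib

/-!
# Crux `PrintCf2.SplitBadTwoRankOneOfFacts` (stmt-BirchSwinnertonDyer-20368), skeleton v13, stub S3d `stub_strictDefectAtVbar_two`, class (iii),
# file 3 of 3: `#(S_{W*}(K*_∞))_Γ = 1` ON EVERY ROAD-α FRAME, MODULO THE ONE LOCAL HYPOTHESIS h𝓛 AT `v̄`

Cell `bsd-print-cf2`, EXTRA WIDTH seat `bsd-line-cf2-p1-w4` g11 (prover-bsd-line-cf2-p1-w4-g11-0); `--supports stmt-BirchSwinnertonDyer-20368`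
(helper, Theses-free). HONEST FRAMING: nothing here closes the crux or a registered stub; BSD is not proved by any of this; no summit statement
is proved by this seat. No definition, no named fact, no `sorry`. CONDITIONAL only on the displayed local hypothesis h𝓛 (the `Γ`-coinvariants of the strict/unramified local defect group at `v̄`
vanish; true on S3d's class (iii), -w6 g4's local half); every other input is a tree theorem.

WHY (S3d, LEAD rulings 01:48:57Z / 02:16:44Z / 02:30:44Z; -w3 g11's spine p690534, 02:47:23Z). With the spine `n′ = n + χ_Γ(Q)`,
`Q := S_{W*}(K*_∞) ⧸ 𝔖_{v̄}(K*_∞, W*)`, the number `e_δ` of S3d is `log₂ #Q^Γ − log₂ #Q_Γ`; on class (iii) (`d ≡ 3 (8)`, `14 (16)`) `Q` embeds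
`Γ`-equivariantly in the local defect group `𝓛 ≅ W* ≅ ℚ₂/ℤ₂(u)`, `v₂(u − 1) = 2`, so `e_δ ∈ {0, 2}` according as `Q` is finite or all of `𝓛`, and
class-uniformity IS «`Q` infinite» ⟺ «`Q_Γ = 0`». `Q_Γ` is a quotient of `(S_nr)_Γ`, and this series of three files proves **`(S_nr)_Γ = 0`** WITHOUT
any global-to-local surjectivity over the line (GV 2000 Prop. 2.1, absent from the tree): exactly as B17 obtained `𝔖_Γ = 0` (-w4 g8
`forall_finite_eq_bot_of_subsingleton_H2_of_baseLift`, -w4 g9 `baseLift_of_locSurj`), from (β)_nr «every `c ∈ H¹(K_∞, M)` with `conj_γ c − c ∈ S_nr`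
is congruent mod `S_nr` to a class restricted from `K`» and `H¹(K_∞, M)_Γ = 0` (`H²(Γ_K, M) = 0`, X11b procyclic descent). The ONE new ingredient
w.r.t. the strict version is the local lift at the distinguished place `𝔮` for the UNRAMIFIED condition: `x := res_{D″} c` is `D_𝔮`-invariant only
modulo `𝓛`; the displayed local hypothesis h𝓛 («`conj_δ − 1` is onto `𝓛` for `δ ∈ D_𝔮 ∖ ker κ`», true in class (iii)) corrects it by an
`ℓ ∈ 𝓛`, and the rescaled procyclic descent (`X11b.ProcyclicDescent.rescale`) lifts the corrected class to `H¹(D_𝔮, M)`.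

CONTENT (`W* = ↥((W.baseChange K).endEigenPrimaryTorsion 2 π r)` on a member `C • W = cm7^{(d)}`, `K` imaginary quadratic with `2 = v v̄`, line `κ'`
unramified outside `v̄` with generator `γ'`):
* **`natCard_endCoinvariants_conjUnr_eq_one_of_frame_of_local`** — from `Finite 𝔖_{v̄}(K, W*)` (hfinB) and h𝓛: (LS) =
  `RestrictedSelmerPair.locSurj_of_frame_of_conjFiniteness` (-w4 g9 p671851 with -w5 g3's discharges and
  `PoitouTateReduction.poitouTate_selmerStructure_duality_holds`), `H²(Γ_K, W*) = 0` = `subsingleton_H2_endEigenPrimaryTorsion_of_frame` (-w4 g9, with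
  `poitouTate_sha_tateDual_holds`, `fieldCdLE_two_of_numberField_holds`, hfinB and -w2 g10's conjugate transport), hul = -w6 g4, side conditions -w7 g2;
* **`natCard_endCoinvariants_conjUnr_eq_one_of_frame`** — the same with S3d's own frame binders, hfinB := cf2c-w2 g2's (FIN)
  `RelaxationLift.finite_restrictedSelmerBase_of_frame` (p688193). On class (iii) frames this is «`Q_Γ = 0`» for -w3 g11's spine (`Q` is a quotient of
  `S_{W*}(K*_∞)`), hence `Q` infinite, `Q = 𝓛`, `e_δ = 2`.
presearch: as file 1; no new fact. beyond-print theorem: no.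

References: [JetchevSkinnerWan2017] Lemma 3.3.3, Prop. 3.3.2; [GreenbergLNM1716] §4 Props. 4.13–4.15; [GreenbergVatsal2000] §2 pp. 17–21;
[Agboola2007] §3 Prop. 3.2, §5 Prop. 5.1; [SerreGaloisCohomology1997] I §2.5–2.6.
-/

noncomputable section

open scoped Classical

set_option linter.dupNamespace false
set_option autoImplicit false

open NumberField IsDedekindDomain Field WeierstrassCurve
open Literature.NumberTheory.EllipticCurves Literature.NumberTheory.EllipticCurves.GreenbergSelmer
open Literature.NumberTheory.EllipticCurves.GreenbergVatsal2000 Literature.NumberTheory.EllipticCurves.KellerYin2024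
open Literature.NumberTheory.EllipticCurves.Agboola2007
open Literature.NumberTheory.EllipticCurves.IwasawaDual
open Literature.NumberTheory.GaloisRepresentations
open Summit.BirchSwinnertonDyer.Rank1Residual.X11b
open Summit.BirchSwinnertonDyer.BirchSwinnertonDyer.Theorems.PrintCf2.RestrictedSelmerPair

namespace Summit.BirchSwinnertonDyer.BirchSwinnertonDyer.Theorems.PrintCf2.UnrBaseLift

/-! ## §1. Road α: `M = W* = ↥((W.baseChange K).endEigenPrimaryTorsion 2 π r)`, line `κ'` unramified outside `v̄` — `#(S_{W*}(K*_∞))_Γ = 1`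
modulo the ONE local hypothesis h𝓛 at `v̄` -/

section Frame

open Summit.BirchSwinnertonDyer.BirchSwinnertonDyer.Theorems.PrintCf2.LineLocallyTrivial
open Summit.BirchSwinnertonDyer.BirchSwinnertonDyer.Theorems.SchneiderFreeAdditiveX3

variable {K : Type} [Field K] [NumberField K]

/-- **`#(S_{W*}(K*_∞))_Γ = 1` ON EVERY ROAD-α FRAME, MODULO h𝓛.** For a member `C • W = cm7^{(d)}` (`d ≠ 0`, `W` globally minimal), `K`
imaginary quadratic with `2 = v v̄`, the `K`-rational `π` with `π² = π − 2`, `r ∈ ℤ₂` with `r² = r − 2`, `W* = ↥((W.baseChange K).endEigenPrimaryTorsion 2 π r)`,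
a `ℤ₂`-line `κ'` unramified outside `v̄` with topological generator `γ'`, and `𝔖_{v̄}(K, W*)` finite (hfinB = (FIN), cf2c-w2 p688193): IF (h𝓛) for
every `δ ∈ D_v̄` outside `ker κ'` the endomorphism `conj_δ − 1` of the local defect group `𝓛 = {ℓ ∈ H¹(ker κ' ∩ D_v̄, W*) | res_{ker κ' ∩ I_v̄} ℓ = 0}`
is ONTO, then `conj_{γ'} − 1` is onto `S_{W*}(K*_∞) = unrSelmer κ' W* v̄ ∅`, i.e. `#H¹(Γ, S_{W*}(K*_∞)) = 1`. Everything else is discharged in the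
tree: (LS) = `RestrictedSelmerPair.locSurj_of_frame_of_conjFiniteness` (-w4 g9 p671851 ∘ -w5 g3's hfinR′/hfix discharges ∘
`PoitouTateReduction.poitouTate_selmerStructure_duality_holds`), `H²(Γ_K, W*) = 0` = `subsingleton_H2_endEigenPrimaryTorsion_of_frame` (-w4 g9, with
`poitouTate_sha_tateDual_holds`, `fieldCdLE_two_of_numberField_holds`, hfinB and its conjugate -w2 g10 `ConjTransport.finite_restrictedSelmerBase_conj_of_finite`),
hul = -w6 g4 `awayKer_eq_unramifiedKer_of_frame`, side conditions -w7 g2. On S3d's class (iii) (`d ≡ 3 (8)` or `d ≡ 14 (16)`) h𝓛 holds because `D″` acts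
trivially on `W*` (-w6 g4 p685012), so `𝓛 = Hom_cont(D″/I″, W*) ≅ W*` is divisible and `δ ∉ ker κ'` acts on it by a scalar `u ∉ {±1}` — -w6 g4's local half;
hence there `Q_Γ = 0` for `Q = S_{W*}(K*_∞) ⧸ 𝔖_{v̄}(K*_∞, W*)`, the bit -w3 g11's spine needs (`e_δ = 2`).
[cite: JetchevSkinnerWan2017, Lemma 3.3.3 and Prop. 3.3.2] [cite: GreenbergLNM1716, §4 Props. 4.13–4.15] [cite: GreenbergVatsal2000, §2 pp. 17–21]
[cite: Agboola2007, §3 Prop. 3.2, §5 Prop. 5.1] -/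
theorem natCard_endCoinvariants_conjUnr_eq_one_of_frame_of_local {d : ℤ} (hd0 : d ≠ 0) (W : WeierstrassCurve ℚ) [W.IsElliptic]
    [W.IsGloballyMinimal] (C : VariableChange ℚ) (hC : C • W = cm7.quadraticTwist (d : ℚ)) (hK : IsImaginaryQuadratic K)
    {v vbar : HeightOneSpectrum (𝓞 K)} (hv : ((2 : ℕ) : 𝓞 K) ∈ v.asIdeal) (hvbar : ((2 : ℕ) : 𝓞 K) ∈ vbar.asIdeal) (hne : vbar ≠ v)
    (π : (W.baseChange K).endRing) (hrel : (π : AddMonoid.End (W.baseChange K).geomPoints) * π = π - 2) {r : ℤ_[2]} (hr : r * r = r - 2)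
    (κ' : ZpExtension K 2) (hκ' : κ'.IsUnramifiedOutside vbar) {γ' : absoluteGaloisGroup K} (hγ' : κ'.IsTopGenerator γ')
    (hfinB : Finite (restrictedSelmerBase ↥((W.baseChange K).endEigenPrimaryTorsion 2 π r) 2 vbar))
    (hL : ∀ δ : decomp (K := K) vbar, (δ : absoluteGaloisGroup K) ∉ κ'.kerSubgroup →
      ∀ a : subgroupH1 (Coinv.kerD κ' vbar) ↥((W.baseChange K).endEigenPrimaryTorsion 2 π r),
        resH1Hom (Coinv.toKerD κ' vbar (kerSubgroup_inf_inertia_le_decomp κ' vbar)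
            (inf_le_left : κ'.kerSubgroup ⊓ inertia vbar ≤ κ'.kerSubgroup))
          (AddMonoidHom.id ↥((W.baseChange K).endEigenPrimaryTorsion 2 π r)) (fun _ _ ↦ rfl) a = 0 →
        ∃ ℓ : subgroupH1 (Coinv.kerD κ' vbar) ↥((W.baseChange K).endEigenPrimaryTorsion 2 π r),
          resH1Hom (Coinv.toKerD κ' vbar (kerSubgroup_inf_inertia_le_decomp κ' vbar)
              (inf_le_left : κ'.kerSubgroup ⊓ inertia vbar ≤ κ'.kerSubgroup))
            (AddMonoidHom.id ↥((W.baseChange K).endEigenPrimaryTorsion 2 π r)) (fun _ _ ↦ rfl) ℓ = 0 ∧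
          conjH1 (Coinv.kerD κ' vbar) ↥((W.baseChange K).endEigenPrimaryTorsion 2 π r) δ ℓ - ℓ = a) :
    Nat.card (EndCoinvariants
      (conjUnr κ' ↥((W.baseChange K).endEigenPrimaryTorsion 2 π r) vbar ∅ γ' - 1)) = 1 := by
  haveI : Fact (Nat.Prime 2) := ⟨Nat.prime_two⟩
  haveI : (W.baseChange K).IsElliptic := by rw [baseChange]; infer_instance
  set M := ↥((W.baseChange K).endEigenPrimaryTorsion 2 π r) with hM
  have hstab : ∀ m : M, IsOpen (MulAction.stabilizer (absoluteGaloisGroup K) m : Set (absoluteGaloisGroup K)) :=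
    fun m ↦ isOpen_stabilizer_endEigenPrimaryTorsion (W.baseChange K) 2 π r m
  have hstab' : ∀ m : M, IsOpen {σ : absoluteGaloisGroup K | σ • m = m} :=
    fun m ↦ isOpen_stabilizer_endEigenPrimaryTorsion (W.baseChange K) 2 π r m
  have htor : ∀ m : M, ∃ k : ℕ, 2 ^ k • m = 0 := exists_pow_smul_endEigenPrimaryTorsion_eq_zero (W.baseChange K) 2 π r
  -- (FIN) at the conjugate frame, H² = 0, (LS)
  have hfinB' := ConjTransport.finite_restrictedSelmerBase_conj_of_finite W K hK v vbar hv hvbar hne π hrel r hfinB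
  have h2 := subsingleton_H2_endEigenPrimaryTorsion_of_frame hd0 W C hC hK v vbar π hrel hr
    (PoitouTateReduction.poitouTate_sha_tateDual_holds K) fieldCdLE_two_of_numberField_holds hfinB hfinB'
  have hLS := locSurj_of_frame_of_conjFiniteness hd0 W C hC hK hv hvbar hne π hrel hr
    (PoitouTateReduction.poitouTate_selmerStructure_duality_holds K)
    (fun e' j' hj' R hR _ ↦ finite_map_selmerGroup_acStructure_of_frame_of_finite hd0 W C hC hK hv hvbar hne π hrel hr hfinB e' j' hj' hR)
    (two_pow_two_nsmul_eq_zero_of_restrictField_fixed_of_frame hd0 W C hC hK hv hvbar hne π hrel hr)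
  -- hul: away from `2`, unramified = locally trivial over the line
  have hul : ∀ w : HeightOneSpectrum (𝓞 K), ((2 : ℕ) : 𝓞 K) ∉ w.asIdeal →
      unramifiedKer κ'.kerSubgroup M w ≤ awayKer κ'.kerSubgroup M w := fun w hw ↦
    (awayKer_eq_unramifiedKer_of_frame W hK hv hvbar hne π r κ' hκ' hw).symm.le
  exact natCard_endCoinvariants_conjUnr_eq_one_of_baseLift κ' M vbar hstab' htor hγ' h2
    (baseLift_unr_of_locSurj κ' M hvbar hstab htor hγ' hul hL (fun S hS τ ↦ hLS S hS τ))

/-- **`#(S_{W*}(K*_∞))_Γ = 1` with the binders of skeleton v13's S3d `stub_strictDefectAtVbar_two` (its frame through `κ'`, `γ'`, the `ℚ`-generator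
datum), MODULO h𝓛 only**: hfinB = (FIN) is cf2c-w2 g2's `RelaxationLift.finite_restrictedSelmerBase_of_frame` (p688193, on -w4 g10 p686044 + -w3 g10 p687682).
On class (iii) frames (where h𝓛 holds, -w6 g4's local half) this is «`Q_Γ = 0`» for -w3 g11's spine (`Q = S_{W*}(K*_∞) ⧸ 𝔖_{v̄}(K*_∞, W*)` is a
quotient of `S_{W*}(K*_∞)`), hence `Q` infinite, `Q = 𝓛`, `e_δ = 2`. [cite: JetchevSkinnerWan2017, Lemma 3.3.3] [cite: GreenbergVatsal2000, §2 Cor. (2.3)]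
[cite: Agboola2007, §5 Prop. 5.1, §6 Prop. 6.10–6.12] -/
theorem natCard_endCoinvariants_conjUnr_eq_one_of_frame
    {d : ℤ} (hd0 : d ≠ 0) (hsq : Squarefree d) (hd4 : d % 4 ≠ 1)
    (W : WeierstrassCurve ℚ) [W.IsElliptic] [W.IsGloballyMinimal] (C : VariableChange ℚ)
    (hC : C • W = cm7.quadraticTwist (d : ℚ)) (hrank : W.analyticRank = 1) (hsha : Finite W.sha)
    (hK : IsImaginaryQuadratic K) {v vbar : HeightOneSpectrum (𝓞 K)}
    (hv : ((2 : ℕ) : 𝓞 K) ∈ v.asIdeal) (hvbar : ((2 : ℕ) : 𝓞 K) ∈ vbar.asIdeal) (hne : vbar ≠ v)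
    (π : (W.baseChange K).endRing) (hrel : (π : AddMonoid.End (W.baseChange K).geomPoints) * π = π - 2)
    {r : ℤ_[2]} (hr : r * r = r - 2)
    (hpin : ∀ τ ∈ GreenbergSelmer.inertia v, ∀ x : ↥((W.baseChange K).endEigenPrimaryTorsion 2 π r), τ • x = x ∨ τ • x = -x)
    (κ' : ZpExtension K 2) (hκ' : κ'.IsUnramifiedOutside vbar) {γ' : absoluteGaloisGroup K} (hγ' : κ'.IsTopGenerator γ')
    (P : W.toAffine.Point) (c₀ : ℕ) (ℓ : ℤ) (hP : ¬ IsOfFinAddOrder P)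
    (hgen : ∀ R : W.toAffine.Point, ∃ (k : ℤ) (T : W.toAffine.Point), IsOfFinAddOrder T ∧ R = k • P + T)
    (hc₀ : c₀ ≠ 0) (hker : (W.baseChange ℚ_[2]).IsInReductionKernel (c₀ • W.toPadicPoint 2 P))
    (hlog : ‖(W.baseChange ℚ_[2]).padicLogPoint (c₀ • W.toPadicPoint 2 P) / (c₀ : ℚ_[2])‖ = (2 : ℝ) ^ (-ℓ))
    (hL : ∀ δ : decomp (K := K) vbar, (δ : absoluteGaloisGroup K) ∉ κ'.kerSubgroup →
      ∀ a : subgroupH1 (Coinv.kerD κ' vbar) ↥((W.baseChange K).endEigenPrimaryTorsion 2 π r),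
        resH1Hom (Coinv.toKerD κ' vbar (kerSubgroup_inf_inertia_le_decomp κ' vbar)
            (inf_le_left : κ'.kerSubgroup ⊓ inertia vbar ≤ κ'.kerSubgroup))
          (AddMonoidHom.id ↥((W.baseChange K).endEigenPrimaryTorsion 2 π r)) (fun _ _ ↦ rfl) a = 0 →
        ∃ ℓ' : subgroupH1 (Coinv.kerD κ' vbar) ↥((W.baseChange K).endEigenPrimaryTorsion 2 π r),
          resH1Hom (Coinv.toKerD κ' vbar (kerSubgroup_inf_inertia_le_decomp κ' vbar)
              (inf_le_left : κ'.kerSubgroup ⊓ inertia vbar ≤ κ'.kerSubgroup))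
            (AddMonoidHom.id ↥((W.baseChange K).endEigenPrimaryTorsion 2 π r)) (fun _ _ ↦ rfl) ℓ' = 0 ∧
          conjH1 (Coinv.kerD κ' vbar) ↥((W.baseChange K).endEigenPrimaryTorsion 2 π r) δ ℓ' - ℓ' = a) :
    Nat.card (EndCoinvariants
      (conjUnr κ' ↥((W.baseChange K).endEigenPrimaryTorsion 2 π r) vbar ∅ γ' - 1)) = 1 :=
  natCard_endCoinvariants_conjUnr_eq_one_of_frame_of_local hd0 W C hC hK hv hvbar hne π hrel hr κ' hκ' hγ'
    (RelaxationLift.finite_restrictedSelmerBase_of_frame d hd0 hsq hd4 W C hC hrank hsha K hK v vbar hv hvbar hne π hrel r hr hpin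
      P c₀ ℓ hP hgen hc₀ hker hlog) hL

end Frame

end Summit.BirchSwinnertonDyer.BirchSwinnertonDyer.Theorems.PrintCf2.UnrBaseLift

end
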